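import Summits.Parity.GeneralizedHardyLittlewood.Theorems.LeeYangFibresRelativeDimOneFloatingSiegelDefs
import Summits.Parity.GeneralizedHardyLittlewood.Theorems.LeeYangFibresRelativeDimOneCharacterNecessity
import HarnessLib

/-!
# Route `LeeYangFibres`, crux `RelativeDimOne` (stmt-Parity-14113), line `floating-level-core`:
# the registered stub `stub_excParsevalLower` — Parseval lower bound at one non-principal character

`ExcParsevalLower` (vocabulary `LeeYangFibresRelativeDimOneFloatingSiegelDefs`): for a non-principal Dirichlet
character `χ mod q` and every `N`,
`(Σ_{n ≤ N, (n,q)=1} Λ(n))² + ‖ψ(N, χ)‖² ≤ φ(q) Σ_{a mod q} ψ(N; q, a)²`.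

Proof (folklore orthogonality on `(ℤ/qℤ)ˣ`, entirely from the tree): Parseval
`Σ_{χ'} ‖ψ(N,χ')‖² = φ(q) Σ_{(a,q)=1} ψ(N;q,a)² ≤ φ(q) Σ_a ψ(N;q,a)²`
(`GallagherBackwards.CharacterNecessity.sum_norm_sq_charPsi_le`); the two distinct terms `χ₀` and `χ ≠ χ₀` of the
non-negative sum are at most the whole sum (`GallagherBackwards.CharacterNecessity.norm_sq_add_norm_sq_le`); and
`ψ(N, χ₀) = Σ_{n ≤ N, (n,q)=1} Λ(n)` is real (`GallagherBackwards.CharacterNecessity.charPsi_one`), so its norm squared is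
the square of that sum.

References: Davenport, *Multiplicative Number Theory*, ch. 20 (orthogonality of characters); Gallagher, Mathematika 23
(1976) §2 [Gallagher1976].
-/

noncomputable section

open scoped BigOperators Classical ArithmeticFunction.vonMangoldt
open Finset Filter Literature.NumberTheory.Sieve
open Summit.Parity.GeneralizedHardyLittlewood.Cruxes.RelativeDimOne.GallagherBackwards (classPsi charPsi)
open Summit.Parity.GeneralizedHardyLittlewood.Cruxes.RelativeDimOne.GallagherBackwardsSplit
open Summit.Parity.GeneralizedHardyLittlewood.Cruxes.RelativeDimOne.TypeSplit

namespace Summit.Parity.GeneralizedHardyLittlewood.Cruxes.RelativeDimOne.FloatingLevelCore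

/-- The principal-character term of Parseval: `‖ψ(N, χ₀)‖² = (Σ_{n ≤ N, (n,q)=1} Λ(n))²`. -/
theorem norm_sq_charPsi_one_eq (q N : ℕ) :
    ‖charPsi (1 : DirichletCharacter ℂ q) N‖ ^ 2 =
      (∑ n ∈ (Finset.Icc 1 N).filter (fun n => n.Coprime q), Λ n) ^ 2 := by
  rw [GallagherBackwards.CharacterNecessity.charPsi_one, Complex.norm_real, Real.norm_eq_abs, sq_abs]

/-- **`stub_excParsevalLower` (P)** — Parseval on `(ℤ/qℤ)ˣ`: for a non-principal `χ mod q`,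
`(Σ_{n ≤ N, (n,q)=1} Λ(n))² + ‖ψ(N, χ)‖² ≤ φ(q) Σ_{a mod q} ψ(N; q, a)²` (keep the two terms `χ₀`, `χ` of
`Σ_{χ'} ‖ψ(N,χ')‖² = φ(q) Σ_{(a,q)=1} ψ(N;q,a)²` and enlarge the coprime classes to all classes). -/
theorem stub_excParsevalLower : ExcParsevalLower := by
  intro q _ χ hχ N
  have h1 := GallagherBackwards.CharacterNecessity.norm_sq_add_norm_sq_le hχ N
  have h2 := GallagherBackwards.CharacterNecessity.sum_norm_sq_charPsi_le (q := q) N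
  rw [norm_sq_charPsi_one_eq] at h1
  linarith

end Summit.Parity.GeneralizedHardyLittlewood.Cruxes.RelativeDimOne.FloatingLevelCore

end
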